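import Mathlib.Data.NNReal.Basic
import Mathlib.Algebra.Group.TypeTags.Basic
import Mathlib.Algebra.Group.Submonoid.Operations
import Mathlib.Algebra.Group.Pi.Lemmas
import Mathlib.Algebra.Group.Equiv.Basic
import Mathlib.Tactic.Positivity
import Mathlib.Tactic.Ring
import Mathlib.Algebra.Category.Grp.Basic
import HarnessLib

/-!
# [IUTchII] Propositions 4.1, 4.3: theta and Gaussian monoids at good primes, labels,
# symmetrizing isomorphisms and diagonals

S. Mochizuki, *Inter-universal Teichmüller theory II*, §4 "Global Gaussian Frobenioids",
Proposition 4.1 (good nonarchimedean `v`, kurims Dec-2020 manuscript pp. 120–122),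
Proposition 4.3 (archimedean `v`, pp. 127–129), Remarks 4.1.1, 4.2.1 (ii)–(iv), 4.3.1, 4.4.1
[cite: Mochizuki2012, Prop 4.1 p.120]. Claim key DISPUTED (D-0012): definitions and Prop-valued
statements only; nothing here asserts a disputed claim.

**What is printed.** (4.1 (ii), p. 121) `Ψ^R_cns(G_v) := (Ψ_cns(G_v)/Ψ_cns(G_v)^×)^rlf ⥲ R_{≥0}(G_v)`
with a distinguished element `log^{G_v}(p_v)`; `Ψ^ss_cns(G_v) := Ψ_cns(G_v)^× × R_{≥0}(G_v)`.
(4.1 (iii), p. 121) symmetrizing isomorphisms between the labeled pairs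
`G_v(Π_v)_t ↷ Ψ_cns(Π_v)_t`, `t ∈ LabCusp^±(Π_v)`, determining diagonal submonoids
`Ψ_cns(Π_v)_{⟨|F_l|⟩} ⊆ ∏_{|t| ∈ |F_l|} Ψ_cns(Π_v)_{|t|}`, `Ψ_cns(Π_v)_{⟨F_l^⋇⟩} ⊆ ∏_{|t| ∈ F_l^⋇}`
and an isomorphism `Ψ_cns(Π_v)_0 ⥲ Ψ_cns(Π_v)_{⟨F_l^⋇⟩}`. (4.1 (iv), p. 122)
`Ψ_env(Π_v) := Ψ_cns(Π_v)^× × {R_{≥0} · log^{Π_v}(p_v) · log^{Π_v}(Θ)}` (a formal symbol),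
`Ψ_gau(Π_v) := Ψ_cns(Π_v)^×_{⟨F_l^⋇⟩} × {R_{≥0} · (…, j² · log^{Π_v}(p_v), …)} ⊆ ∏_{j ∈ F_l^⋇} Ψ^ss_cns(Π_v)_j`
and the **formal evaluation isomorphism** `Ψ_env(Π_v) ⥲ Ψ_gau(Π_v)`,
`log(p_v)·log(Θ) ↦ (…, j²·log(p_v), …)`, "which restricts to the identity on the respective
copies of `Ψ_cns(Π_v)^×` and is compatible with … the natural splittings". Proposition 4.3
(ii)–(iv) prints the same shapes at archimedean `v` with `U_v`, `D^⊢_v` in place of `Π_v`, `G_v`.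

**Dictionary.** The natural-number representatives `{1,…,l⋇}` of `F_l^⋇` are `Fin lstar :=
Fin lstar` with `j ↦ j+1` ("by abuse of notation, we also write `j` for the natural number
`∈ {1,…,l⋇}` determined by `j`", p. 122); the label sets themselves are abc-iut-L5-t1's
`Literature.IUT.HodgeTheaters.FlStar` / `FlAbs` (dedup ruling C9: not redeclared here). `R_{≥0}(G_v)` is recorded AS `ℝ≥0` (written multiplicatively,
`Multiplicative ℝ≥0`) together with the distinguished element `log(p_v) > 0` (`LogRealDatum`);
the unit group `Ψ_cns^×` is an abstract `CommGroup U`. The Galois actions and topologies are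
suppressed here (recorded in the file on Definition 4.9); the objects below are the MONOIDS
and SPLITTINGS of Propositions 4.1/4.3, which is exactly what (ii) and (iv) print.

**Constructed and proved.** The diagonal submonoid and `Ψ_0 ⥲ Ψ_{⟨F_l^⋇⟩}` (an isomorphism
for `l⋇ ≥ 1`); `Ψ_env`, `Ψ_gau` and the formal evaluation map as a `MonoidHom`, injective, hence
the evaluation ISOMORPHISM `Ψ_env ⥲ Ψ_gau`, identity on units, compatible with splittings.
Interfaces (not constructed here): the group-theoretic constant monoid `Ψ_cns(G_v)` of 4.1 (i)
([AbsTopIII] Cor 1.10 (b); owner abc-iut-L4-t1) and `Ψ_cns(U_v) = A^▷` of 4.3 (i)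
([IUTchI] Ex 3.4; owner abc-iut-L5-t2), recorded as `ConstantMonoidDatum`.
-/

namespace Literature.IUT.HodgeArakelov

open scoped NNReal

universe u v

/-! ### 1. Labels: natural-number representatives of `F_l^⋇` (p. 122; [IUTchI] §0) -/

/-- "the natural number `∈ {1,…,l⋇}` determined by an element `j ∈ F_l^⋇`" ([IUTchII] Prop 4.1 (iv)
p. 122): the labels enter the constructions below only through these natural numbers, so we index
by `Fin lstar` (`i ↦ i + 1`) directly. The label sets `F_l^⋇ = F_l^×/{±1}`, `l⋇`, `|F_l|` themselves are
abc-iut-L5-t1's `Literature.IUT.HodgeTheaters.FlStar` / `lStar` / `FlAbs` (`Labels.lean`; dedup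
ruling C9: not redeclared here). -- TODO-merge: abc-iut-L5-t1 (the enumeration
`FlStar l ≃ Fin (lStar l)` by least positive representative). [cite: Mochizuki2012, Prop 4.1 (iv) p.122] -/
def labelNat {lstar : ℕ} (j : Fin lstar) : ℕ := j.val + 1

/-- `1 ≤ j ≤ l⋇` for the natural number of a label. [cite: Mochizuki2012, Prop 4.1 (iv) p.122] -/
theorem one_le_labelNat {lstar : ℕ} (j : Fin lstar) : 1 ≤ labelNat j ∧ labelNat j ≤ lstar :=
  ⟨Nat.succ_le_succ (Nat.zero_le _), j.isLt⟩

/-! ### 2. Labeled copies, symmetrizing isomorphisms, diagonals (Prop 4.1 (iii), 4.3 (iii)) -/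

section Diagonal

variable {T : Type u} {M : Type v} [CommMonoid M]

/-- The **diagonal submonoid** `M_{⟨T⟩} ⊆ ∏_{t ∈ T} M_t` of the product of copies of a monoid
`M` labeled by `t ∈ T`, "determined by [the] symmetrizing isomorphisms" between the copies
([IUTchII] Prop 4.1 (iii) p. 121: `Ψ_cns(Π_v)_{⟨|F_l|⟩} ⊆ ∏ Ψ_cns(Π_v)_{|t|}`,
`Ψ_cns(Π_v)_{⟨F_l^⋇⟩} ⊆ ∏ Ψ_cns(Π_v)_{|t|}`; Prop 4.3 (iii) p. 128; Cor 3.5 (i) p. 94). Copies are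
literal copies, so the symmetrizing isomorphisms are identities and the diagonal is the set of
constant families. [cite: Mochizuki2012, Prop 4.1 (iii) p.121] -/
def diagonalSubmonoid (T : Type u) (M : Type v) [CommMonoid M] : Submonoid (T → M) where
  carrier := {x | ∀ t t' : T, x t = x t'}
  one_mem' := fun _ _ => rfl
  mul_mem' := fun {a b} ha hb t t' => by
    simp only [Pi.mul_apply]
    rw [ha t t', hb t t']

/-- Membership in the diagonal. [cite: Mochizuki2012, Prop 4.1 (iii) p.121] -/
theorem mem_diagonalSubmonoid (x : T → M) :
    x ∈ diagonalSubmonoid T M ↔ ∀ t t' : T, x t = x t' := Iff.rfl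

/-- The **diagonal embedding** `M ⥲ M_{⟨T⟩} ⊆ ∏_T M` of the copy labeled `0` (or of any one copy)
onto the diagonal — the map underlying "`Ψ_cns(Π_v)_0 ⥲ Ψ_cns(Π_v)_{⟨F_l^⋇⟩}`" ([IUTchII]
Prop 4.1 (iii) p. 121–122; Prop 4.3 (iii) p. 128; Cor 3.5 (iii) p. 95 "the diagonal submonoid …
may be thought of as the graph of an isomorphism"). [cite: Mochizuki2012, Prop 4.1 (iii) p.121] -/
def diagonalEmbedding (T : Type u) (M : Type v) [CommMonoid M] : M →* (T → M) where
  toFun m := fun _ => m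
  map_one' := rfl
  map_mul' _ _ := rfl

/-- The diagonal embedding lands in the diagonal submonoid. [cite: Mochizuki2012, Prop 4.1 (iii) p.121] -/
theorem diagonalEmbedding_mem (m : M) : diagonalEmbedding T M m ∈ diagonalSubmonoid T M :=
  fun _ _ => rfl

/-- The range of the diagonal embedding is exactly the diagonal submonoid when `T` is
nonempty. [cite: Mochizuki2012, Prop 4.1 (iii) p.121] -/
theorem mrange_diagonalEmbedding [Nonempty T] :
    MonoidHom.mrange (diagonalEmbedding T M) = diagonalSubmonoid T M := by
  ext x
  constructor
  · rintro ⟨m, rfl⟩; exact diagonalEmbedding_mem m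
  · intro hx
    obtain ⟨t₀⟩ := ‹Nonempty T›
    exact ⟨x t₀, funext fun t => hx t₀ t⟩

/-- The diagonal embedding is injective when `T` is nonempty (so "`Ψ_0 ⥲ Ψ_{⟨F_l^⋇⟩}`" is an
ISOMORPHISM onto the diagonal as soon as `l⋇ ≥ 1`). [cite: Mochizuki2012, Prop 4.1 (iii) p.121] -/
theorem diagonalEmbedding_injective [Nonempty T] :
    Function.Injective (diagonalEmbedding T M) := by
  obtain ⟨t₀⟩ := ‹Nonempty T›
  intro a b h
  exact congrFun h t₀

/-- `Ψ_0 ⥲ Ψ_{⟨T⟩}`: the isomorphism of the zero-labeled copy with the diagonal submonoid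
([IUTchII] Prop 4.1 (iii) p. 121–122, Prop 4.3 (iii) p. 128, Cor 3.5 (iii) p. 95), for `T`
nonempty. [cite: Mochizuki2012, Prop 4.1 (iii) p.121] -/
noncomputable def diagonalIso (T : Type u) (M : Type v) [CommMonoid M] [Nonempty T] :
    M ≃* diagonalSubmonoid T M :=
  (MulEquiv.ofBijective (diagonalEmbedding T M).mrangeRestrict
    ⟨fun _ _ h => diagonalEmbedding_injective (congrArg Subtype.val h),
     MonoidHom.mrangeRestrict_surjective _⟩).trans
    (MulEquiv.submonoidCongr mrange_diagonalEmbedding)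

end Diagonal

/-! ### 3. `R_{≥0}(−)` with its distinguished element; semi-simplified constant monoids
(Prop 4.1 (ii) p. 121, Prop 4.3 (ii) p. 127, Remark 4.2.1 (i) p. 125) -/

/-- INTERFACE datum for "a topological monoid `R_{≥0}(G_v)` [resp. `R_{≥0}(D^⊢_v)`] equipped
with a natural isomorphism `Ψ^R_cns ⥲ R_{≥0}(−)` and a distinguished element `log(p_v)`"
([IUTchII] Prop 4.1 (ii) p. 121 via [IUTchI] Ex 3.5 (iii), [AbsTopIII] Prop 5.8 (iii); Prop 4.3
(ii) p. 127): we take the monoid to BE `ℝ≥0` and record the distinguished element, which is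
positive (`p_v > 1`, resp. `p_v = e`, p. 130). -- TODO-merge: abc-iut-L5-t2 ([IUTchI] Ex 3.5),
abc-iut-L4-t3 ([AbsTopIII] Prop 5.8). [cite: Mochizuki2012, Prop 4.1 (ii) p.121] -/
structure LogRealDatum where
  /-- the distinguished element `log(p_v) ∈ R_{≥0}(−)` -/
  logp : ℝ≥0
  /-- it is nonzero -/
  logp_pos : 0 < logp

/-- INTERFACE datum for the constant monoid with its units: `Ψ_cns(G_v)` "naturally isomorphic
to `O^▷_{F̄_v}`" (Prop 4.1 (i) p. 120, from [AbsTopIII] Cor 1.10 (b)) / `Ψ_cns(U_v) := A^▷_{U_v}`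
(Prop 4.3 (i) p. 127): here only its group of units `Ψ_cns^×` is consumed, as an abstract
commutative group. -- TODO-merge: abc-iut-L4-t1 (Cor 1.10), abc-iut-L5-t2 (Ex 3.4).
[cite: Mochizuki2012, Prop 4.1 (i) p.120] -/
structure ConstantMonoidDatum where
  /-- the group of units `Ψ_cns(−)^×` (bundled, Mathlib `CommGrpCat`; v2: no instance attribute) -/
  Units : CommGrpCat.{u}
  /-- `R_{≥0}(−)` with `log(p_v)` -/
  logReal : LogRealDatum

namespace ConstantMonoidDatum

variable (Ψ : ConstantMonoidDatum.{u})

/-- `Ψ^ss_cns := Ψ_cns^× × R_{≥0}(−)`, the **mono-analytic semi-simplification** ([IUTchII]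
Prop 4.1 (ii) p. 121; Prop 4.3 (ii) p. 127; Remark 4.2.1 (i) p. 125 at bad `v`), with its
tautological splitting as a product. [cite: Mochizuki2012, Prop 4.1 (ii) p.121] -/
abbrev SemiSimplified : Type u := Ψ.Units × Multiplicative ℝ≥0

/-- `Ψ_env := Ψ_cns^× × {R_{≥0} · log(p_v) · log(Θ)}`, the **theta monoid** at a good place
([IUTchII] Prop 4.1 (iv) p. 122; Prop 4.3 (iv) p. 128): the second factor is the free half-line
on the formal symbol `log(p_v)·log(Θ)`, coordinatised by the coefficient `c ∈ R_{≥0}`.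
[cite: Mochizuki2012, Prop 4.1 (iv) p.122] -/
abbrev ThetaMonoid : Type u := Ψ.Units × Multiplicative ℝ≥0

variable (lstar : ℕ)

/-- The `j`-th component `c · j² · log(p_v) ∈ R_{≥0}(−)_j` of the "vector of ratios"
`(…, j²·log(p_v), …)` scaled by `c` ([IUTchII] Prop 4.1 (iv) p. 122).
[cite: Mochizuki2012, Prop 4.1 (iv) p.122] -/
def weight (c : ℝ≥0) (j : Fin lstar) : ℝ≥0 := c * ((labelNat j : ℝ≥0) ^ 2 * Ψ.logReal.logp)

/-- The **formal evaluation map** `Ψ_env → ∏_{j ∈ F_l^⋇} Ψ^ss_cns,j`,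
`(u, c·log(p_v)·log(Θ)) ↦ (j ↦ (u, c·j²·log(p_v)))` ([IUTchII] Prop 4.1 (iv) p. 122,
"`log^{Π_v}(p_v)·log^{Π_v}(Θ) ↦ (…, j²·log^{Π_v}(p_v), …)`"; Prop 4.3 (iv) p. 128), as a monoid
homomorphism. [cite: Mochizuki2012, Prop 4.1 (iv) p.122] -/
def evalHom : Ψ.ThetaMonoid →* (Fin lstar → Ψ.SemiSimplified) where
  toFun x := fun j => (x.1, Multiplicative.ofAdd (Ψ.weight lstar (Multiplicative.toAdd x.2) j))
  map_one' := by
    funext j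
    simp [weight]
  map_mul' x y := by
    funext j
    simp only [Pi.mul_apply, Prod.mk_mul_mk, Prod.fst_mul, Prod.snd_mul, weight, toAdd_mul,
      add_mul, ofAdd_add]

/-- `Ψ_gau := Ψ_cns^×_{⟨F_l^⋇⟩} × {R_{≥0}·(…, j²·log(p_v), …)} ⊆ ∏_j Ψ^ss_cns,j`, the **Gaussian
monoid** at a good place ([IUTchII] Prop 4.1 (iv) p. 122; Prop 4.3 (iv) p. 128), realised as
the image of the formal evaluation map. [cite: Mochizuki2012, Prop 4.1 (iv) p.122] -/
def GaussianMonoid : Submonoid (Fin lstar → Ψ.SemiSimplified) :=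
  MonoidHom.mrange (Ψ.evalHom lstar)

/-- The unit part of every element of `Ψ_gau` is DIAGONAL (`Ψ_cns^×_{⟨F_l^⋇⟩}`), as printed
([IUTchII] Prop 4.1 (iv) p. 122). [cite: Mochizuki2012, Prop 4.1 (iv) p.122] -/
theorem gaussianMonoid_units_diagonal {x : Fin lstar → Ψ.SemiSimplified}
    (hx : x ∈ Ψ.GaussianMonoid lstar) : (fun j => (x j).1) ∈ diagonalSubmonoid (Fin lstar) Ψ.Units := by
  obtain ⟨y, rfl⟩ := hx
  intro t t'
  rfl

/-- The formal evaluation map is injective as soon as `l⋇ ≥ 1` (uses `log(p_v) > 0` and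
`j ≥ 1`). [cite: Mochizuki2012, Prop 4.1 (iv) p.122] -/
theorem evalHom_injective (hl : 0 < lstar) : Function.Injective (Ψ.evalHom lstar) := by
  intro x y h
  have h0 := congrFun h ⟨0, hl⟩
  simp only [evalHom, MonoidHom.coe_mk, OneHom.coe_mk, Prod.mk.injEq] at h0
  obtain ⟨h1, h2⟩ := h0
  have h2' := congrArg Multiplicative.toAdd h2
  simp only [toAdd_ofAdd, weight, labelNat] at h2'
  have hpos : (0 : ℝ≥0) < (((0 : ℕ) + 1 : ℕ) : ℝ≥0) ^ 2 * Ψ.logReal.logp := by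
    have := Ψ.logReal.logp_pos
    positivity
  have h3 : Multiplicative.toAdd x.2 = Multiplicative.toAdd y.2 := mul_right_cancel₀ hpos.ne' h2'
  exact Prod.ext h1 (Multiplicative.toAdd.injective h3)

/-- The **formal evaluation isomorphism** `Ψ_env ⥲ Ψ_gau` ([IUTchII] Prop 4.1 (iv) p. 122;
Prop 4.3 (iv) p. 128), for `l⋇ ≥ 1`. [cite: Mochizuki2012, Prop 4.1 (iv) p.122] -/
noncomputable def evalIso (hl : 0 < lstar) : Ψ.ThetaMonoid ≃* Ψ.GaussianMonoid lstar :=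
  MulEquiv.ofBijective (Ψ.evalHom lstar).mrangeRestrict
    ⟨fun _ _ h => Ψ.evalHom_injective lstar hl (congrArg Subtype.val h),
     MonoidHom.mrangeRestrict_surjective _⟩

/-- The evaluation isomorphism "restricts to the identity on the respective copies of
`Ψ_cns^×`": on `(u, 0)` it is the diagonal embedding of `u` with trivial `R_{≥0}`-part
([IUTchII] Prop 4.1 (iv) p. 122). [cite: Mochizuki2012, Prop 4.1 (iv) p.122] -/
theorem evalHom_unit (u : Ψ.Units) (j : Fin lstar) :
    Ψ.evalHom lstar (u, 1) j = (u, 1) := by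
  simp [evalHom, weight]

/-- Compatibility with the natural splittings: the `R_{≥0}`-ray `{1} × R_{≥0}·log(p_v)log(Θ)`
of `Ψ_env` maps to the ray `{1} × R_{≥0}·(…, j²·log(p_v), …)` of `Ψ_gau` ([IUTchII] Prop 4.1
(iv) p. 122 "compatible with … the natural splittings on the domain and codomain").
[cite: Mochizuki2012, Prop 4.1 (iv) p.122] -/
theorem evalHom_ray (c : ℝ≥0) (j : Fin lstar) :
    Ψ.evalHom lstar (1, Multiplicative.ofAdd c) j =
      (1, Multiplicative.ofAdd (c * ((labelNat j : ℝ≥0) ^ 2 * Ψ.logReal.logp))) := by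
  simp [evalHom, weight]

/-- Remark 4.2.1 (ii) (p. 126): at good `v` the monoids `Ψ_env`, `Ψ_gau` "are already
divisible", so one sets `∞Ψ_env := Ψ_env`, `∞Ψ_gau := Ψ_gau`. Recorded: the `R_{≥0}`-part is
divisible (`n`-th roots exist for `n ≥ 1`). [cite: Mochizuki2012, Rmk 4.2.1 (ii) p.126] -/
theorem ray_divisible (c : ℝ≥0) (n : ℕ) (hn : 0 < n) :
    ∃ d : ℝ≥0, (Multiplicative.ofAdd d) ^ n = Multiplicative.ofAdd c := by
  refine ⟨c / n, ?_⟩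
  rw [← ofAdd_nsmul, nsmul_eq_mul]
  congr 1
  have hn' : (n : ℝ≥0) ≠ 0 := by exact_mod_cast hn.ne'
  field_simp

/-- `∞Ψ_env := Ψ_env` at good `v` (Remark 4.2.1 (ii) p. 126; Remark 4.4.1 p. 131 at
archimedean `v`). [cite: Mochizuki2012, Rmk 4.2.1 (ii) p.126] -/
abbrev InftyThetaMonoid : Type u := Ψ.ThetaMonoid

/-- `∞Ψ_gau := Ψ_gau` at good `v` (Remark 4.2.1 (ii) p. 126; Remark 4.4.1 p. 131).
[cite: Mochizuki2012, Rmk 4.2.1 (ii) p.126] -/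
abbrev InftyGaussianMonoid : Submonoid (Fin lstar → Ψ.SemiSimplified) := Ψ.GaussianMonoid lstar

end ConstantMonoidDatum

/-! ### 4. The remaining sub-items of Propositions 4.1, 4.3 as named statements

Items (i) and the Galois-action/label clauses of (iii) are RECONSTRUCTION statements
("functorial group-theoretic algorithm in the topological group `Π_v` [resp. in the
Aut-holomorphic space `U_v`] for constructing …"); their inputs ([AbsTopIII] Cor 1.10 (b),
Cor 2.7 (e); [IUTchI] Cor 1.2, Ex 3.4, Def 6.1 (iii)) are not in the tree. They are recorded
as Prop-valued fields of an interface whose docstrings quote print. -/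

/-- INTERFACE: the statement-level content of [IUTchII] Proposition 4.1 (i), (iii) at
`v ∈ V^good ∩ V^non` (pp. 120–122) and Proposition 4.3 (i), (iii) at `v ∈ V^arc` (pp. 127–128),
over named inputs. Fields are Prop-valued and quote print; none is asserted.
-- TODO-merge: abc-iut-L4-t1 ([AbsTopIII] Cor 1.10), abc-iut-L4-t2 (Cor 2.7), abc-iut-L5-t1
([IUTchI] Cor 1.2), abc-iut-L5-t4 ([IUTchI] Def 6.1 (iii) `LabCusp^±`).
[cite: Mochizuki2012, Prop 4.1 p.120] -/
structure GoodPlaceReconstructionStatements where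
  /-- 4.1 (i) p. 120: "The functorial group-theoretic algorithm of [AbsTopIII], Corollary 1.10,
  (b) … yields a functorial group-theoretic algorithm in the topological group `G_v` for
  constructing the ind-topological submonoid [naturally isomorphic to `O^▷_{F̄_v}`]
  `Ψ_cns(G_v) ⊆ lim_J H¹(J, μ_Ẑ(G_v))` … equipped with its natural `G_v`-action", and
  `Ψ_cns(Π_v) := Ψ_cns(G_v(Π_v))`. -/
  constantMonoid_nonarch : Prop
  /-- 4.3 (i) p. 127: "There is a functorial algorithm in the Aut-holomorphic space `U_v` for
  constructing the topological monoid `Ψ_cns(U_v) := A^▷_{U_v}`" and the tautological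
  isomorphism `Ψ_cns(U_v) ⥲ Ψ_cns(D^⊢_v(U_v))`. -/
  constantMonoid_arch : Prop
  /-- 4.1 (iii) p. 121 / 4.3 (iii) p. 128: the `Δ^±_v`-outer action of `F_l^⋊± ≅ Δ^cor_v/Δ^±_v`
  on `Π^±_v` [resp. the action of `F_l^⋊± ≅ Gal(U^±_v/U^cor_v)`] "induces isomorphisms between
  the pairs `G_v(Π_v)_t ↷ Ψ_cns(Π_v)_t` [resp. `Ψ_cns(U_v)_t`] for distinct
  `t ∈ LabCusp^±(−)`" — the `F_l^⋊±`-symmetrizing isomorphisms — compatible with the diagonal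
  submonoids `diagonalSubmonoid` and the isomorphism `diagonalIso` above. -/
  symmetrizing : Prop

/-- Remark 4.1.1 (iii) (p. 123), (a)/(b): "the construction of the monoids `Ψ_cns(Π_v)` is
uniradial, while the construction of the monoids `Ψ^ss_cns(Π_v)`, `Ψ_env(Π_v)`, `Ψ_gau(Π_v)`
…, as well as of the isomorphism `Ψ_env(Π_v) ⥲ Ψ_gau(Π_v)`, is multiradial" — an "easy
tautological formal analogue" whose details are "left to the reader". Recorded as a pair of
named Prop slots over the radial-environment vocabulary of [IUTchII] Example 1.7 (owner
abc-iut-L6-t1). -- TODO-merge: abc-iut-L6-t1 (Example 1.7 (ii) uniradial/multiradial).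
[cite: Mochizuki2012, Rmk 4.1.1 (iii) p.123] -/
structure Remark411Statements where
  /-- (a) `Ψ_cns(Π_v)` is uniradially defined -/
  constantMonoid_uniradial : Prop
  /-- (b) `Ψ^ss_cns`, `Ψ_env`, `Ψ_gau` and `Ψ_env ⥲ Ψ_gau` are multiradially defined -/
  semisimplified_multiradial : Prop

end Literature.IUT.HodgeArakelov
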